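import Literature.AlgebraicGeometry.Resolution.BlowupChartQuotients
import Literature.AlgebraicGeometry.Resolution.BlowupChartRegular
import Literature.AlgebraicGeometry.Resolution.RsopMonomialIdeals
import Mathlib.RingTheory.Localization.LocalizationLocalization
import Mathlib.RingTheory.MvPolynomial.Localization
import Mathlib.RingTheory.RegularLocalRing.Polynomial
import Mathlib.RingTheory.KrullDimension.NonZeroDivisors
import HarnessLib

/-!
# Simple normal crossings on a blow-up chart: the local rings over the centre (ring level)

Topic: `Literature/AlgebraicGeometry/Resolution`. The local algebra behind the persistence of
simple normal crossings under admissible blow-ups (Kollár 2007, Def. 3.25; BGMW 2011,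
Def. 3.1.3 (2), (4)), continuing `BlowupChartQuotients.lean`.

Setting. `R` is a ring with a prime `𝔭`, `A = R_𝔭` is a regular local ring whose maximal ideal
has the regular system of parameters `x_1, …, x_r, w_1, …, w_a` (images of elements of `R`);
`x` is quasi-regular in `R` (e.g. after shrinking, `RegularCentreLocal.lean`) and `I = (x)` is
the centre; `B = (R[It])_{(x_i t)}` is a chart of the blowing up with structure map `φ` and chart
generators `e_j` (`φ x_j = φ x_i · e_j`); `Q ⊂ B` is a prime over `𝔭` and `S = B_Q` (the local
ring of the blow-up at a point of the exceptional divisor over the closed point of `A`).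

PROVED:

* `exists_equiv_quotient_chartStageIdeal` — for an ideal `K ⊆ 𝔭` of `R` and a set `T` of
  indices `j ≠ i` with `e_j ∈ Q`, the ring `S / ((x_i) + K + (e_j)_T) S` is isomorphic to the
  localization at a prime of the polynomial ring `(A/(I + K)A)[T_j : j ≠ i, j ∉ T]`, `φ(s) ↦ s̄`,
  `e_j ↦ T_j` (`chartStageEquiv` of `BlowupChartQuotients.lean`, localized); hence
  (`isDomain_quotient_map_chartStageIdeal`, `mk_algebraMap_reesChartBase_ne_zero`,
  `mk_algebraMap_chartGen_ne_zero`, `isRegularLocalRing_quotient_map_chartStageIdeal`) these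
  quotients are domains in which the remaining `w_m` and `e_j` are nonzero when `A/(I + K)A` is a
  domain, and regular local rings when `A/(I + K)A` is a regular ring (the residue field);
* `isRsopPart_chartRsopFamily`, `exists_rsop_chart` — **`S` is a regular local ring and `x_i`,
  the `w_m`, and the `e_j ∈ Q` (`j ≠ i`) sit at distinct positions of a regular system of
  parameters of `S`** (peeling off one element at a time,
  `ringKrullDim_quotient_succ_le_of_nonZeroDivisor`, and the criterion
  `IsRsopPart.of_isRegularLocalRing_quotient`);
* `iSup_colon_span_w_eq`, `iSup_colon_span_x_eq`, `iSup_colon_span_x_self_eq_top` — the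
  saturations `⋃ₙ ((w_m) : x_iⁿ) = (w_m)`, `⋃ₙ ((x_j) : x_iⁿ) = (e_j)` (`j ≠ i`),
  `⋃ₙ ((x_i) : x_iⁿ) = S` in `S` (the stalks of the strict transforms of the hypersurfaces
  `V(w_m)`, `V(x_j)`, `V(x_i)`).

## Sources

* J. Kollár, *Lectures on Resolution of Singularities* (2007), Def. 3.24–3.25. [Kollar2007]
* E. Bierstone, D. Grigoriev, P. Milman, J. Włodarczyk, arXiv:1206.3090, Def. 3.1.1,
  Def. 3.1.3 (2), (4). [BierstoneGrigorievMilmanWlodarczyk2011]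
* The Stacks Project, Tag 0BIQ. [StacksProject]
* H. Matsumura, *Commutative Ring Theory* (1986), Thm. 14.2 and Remark. [Matsumura1987]
-/

noncomputable section

open Polynomial HomogeneousLocalization IsLocalRing

namespace Literature.AlgebraicGeometry.Resolution

universe u

/-! ## Generic localization lemmas -/

section Generic

/-- **Quotients of a localization at a prime, along an isomorphism of the base.** If `S = B_Q`,
`J ⊆ Q`, and `ε : P ≅ B/J`, then `S/JS` is the localization of `P` at the prime `𝔔`
corresponding to `Q/J`, for the `P`-algebra structure `P ≅ B/J → S/JS`. [folklore] -/
theorem isLocalization_atPrime_quotient_of_ringEquiv {B S P : Type*} [CommRing B] [CommRing S]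
    [CommRing P] [Algebra B S] (Q : Ideal B) [Q.IsPrime] [IsLocalization.AtPrime S Q]
    (J : Ideal B) (ε : P ≃+* B ⧸ J) (𝔔 : Ideal P) [𝔔.IsPrime]
    (h𝔔 : ∀ b : B, ε.symm (Ideal.Quotient.mk J b) ∈ 𝔔 ↔ b ∈ Q) :
    @IsLocalization.AtPrime P _ (S ⧸ J.map (algebraMap B S)) _
      ((algebraMap (B ⧸ J) (S ⧸ J.map (algebraMap B S))).comp ε.toRingHom).toAlgebra 𝔔 _ := by
  have inst : IsLocalization (Algebra.algebraMapSubmonoid (B ⧸ J) Q.primeCompl)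
      (S ⧸ J.map (algebraMap B S)) := inferInstance
  have h := @IsLocalization.isLocalization_of_base_ringEquiv (B ⧸ J) _
    (Algebra.algebraMapSubmonoid (B ⧸ J) Q.primeCompl) (S ⧸ J.map (algebraMap B S)) _ _ P _
    inst ε.symm
  have hM : (Algebra.algebraMapSubmonoid (B ⧸ J) Q.primeCompl).map ε.symm = 𝔔.primeCompl := by
    ext p
    constructor
    · rintro ⟨_, ⟨b, hb, rfl⟩, rfl⟩
      exact fun hp => hb ((h𝔔 b).mp hp)
    · intro hp
      obtain ⟨b, hb⟩ := Ideal.Quotient.mk_surjective (ε p)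
      refine ⟨Ideal.Quotient.mk J b, ⟨b, fun hbQ => hp ?_, rfl⟩, ?_⟩
      · have := (h𝔔 b).mpr hbQ
        rwa [hb, RingEquiv.symm_apply_apply] at this
      · change ε.symm (Ideal.Quotient.mk J b) = p
        rw [hb, RingEquiv.symm_apply_apply]
  rw [hM] at h
  have halg : ((algebraMap (B ⧸ J) (S ⧸ J.map (algebraMap B S))).comp ε.symm.symm.toRingHom) =
      (algebraMap (B ⧸ J) (S ⧸ J.map (algebraMap B S))).comp ε.toRingHom := by
    rw [RingEquiv.symm_symm]
  rw [halg] at h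
  exact h

/-- **A localization at a prime which factors through an intermediate localization.** If
`Sb = (T₀)_𝔔₀` and `T₁ = N⁻¹ T₀` with `N ∩ 𝔔₀ = ∅`, then `Sb ≅ (T₁)_{𝔔₀ T₁}` over `T₀`.
[folklore] -/
theorem exists_algEquiv_localization_atPrime_map {T₀ T₁ Sb : Type*} [CommRing T₀] [CommRing T₁]
    [CommRing Sb] [Algebra T₀ T₁] [Algebra T₀ Sb] (𝔔₀ : Ideal T₀) [𝔔₀.IsPrime]
    [IsLocalization.AtPrime Sb 𝔔₀] (N : Submonoid T₀) [IsLocalization N T₁]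
    (hN : Disjoint (N : Set T₀) 𝔔₀) :
    ∃ 𝔔₁ : PrimeSpectrum T₁, 𝔔₁.asIdeal = 𝔔₀.map (algebraMap T₀ T₁) ∧
      𝔔₁.asIdeal.comap (algebraMap T₀ T₁) = 𝔔₀ ∧
      Nonempty (Sb ≃ₐ[T₀] Localization.AtPrime 𝔔₁.asIdeal) := by
  have hprime : (𝔔₀.map (algebraMap T₀ T₁)).IsPrime :=
    IsLocalization.isPrime_of_isPrime_disjoint N T₁ 𝔔₀ ‹_› hN
  let 𝔔₁ : PrimeSpectrum T₁ := ⟨𝔔₀.map (algebraMap T₀ T₁), hprime⟩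
  have hcomap : 𝔔₁.asIdeal.comap (algebraMap T₀ T₁) = 𝔔₀ :=
    IsLocalization.under_map_of_isPrime_disjoint N T₁ ‹_› hN
  refine ⟨𝔔₁, rfl, hcomap, ?_⟩
  have h2 : IsLocalization.AtPrime (Localization.AtPrime 𝔔₁.asIdeal)
      (𝔔₁.asIdeal.comap (algebraMap T₀ T₁)) :=
    IsLocalization.isLocalization_isLocalization_atPrime_isLocalization N
      (Localization.AtPrime 𝔔₁.asIdeal) 𝔔₁.asIdeal
  have hsub : (𝔔₁.asIdeal.comap (algebraMap T₀ T₁)).primeCompl = 𝔔₀.primeCompl := by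
    ext t
    rw [Ideal.mem_primeCompl_iff, Ideal.mem_primeCompl_iff, hcomap]
  have h3 : IsLocalization.AtPrime (Localization.AtPrime 𝔔₁.asIdeal) 𝔔₀ := by
    unfold IsLocalization.AtPrime at h2 ⊢
    rw [hsub] at h2
    exact h2
  exact ⟨IsLocalization.algEquiv 𝔔₀.primeCompl Sb (Localization.AtPrime 𝔔₁.asIdeal)⟩

/-- **Dimension drops by at least one modulo a nonzero element of a domain quotient**:
if `S/J` is a domain and `z̄ ≠ 0` in it, then `dim S/(J + (z)) + 1 ≤ dim S/J`
(`ringKrullDim_quotient_succ_le_of_nonZeroDivisor` in `S/J`, and `(S/J)/(z̄) ≅ S/(J + (z))`).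
[folklore] -/
theorem ringKrullDim_quotient_sup_span_singleton_succ_le {S : Type*} [CommRing S] (J : Ideal S)
    (z : S) [IsDomain (S ⧸ J)] (hz : Ideal.Quotient.mk J z ≠ 0) :
    ringKrullDim (S ⧸ (J ⊔ Ideal.span {z})) + 1 ≤ ringKrullDim (S ⧸ J) := by
  have hnzd : Ideal.Quotient.mk J z ∈ nonZeroDivisors (S ⧸ J) := mem_nonZeroDivisors_of_ne_zero hz
  have h := ringKrullDim_quotient_succ_le_of_nonZeroDivisor hnzd
  have heq : Ideal.span {Ideal.Quotient.mk J z} = (Ideal.span {z}).map (Ideal.Quotient.mk J) := by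
    rw [Ideal.map_span, Set.image_singleton]
  have e : (S ⧸ J) ⧸ Ideal.span {Ideal.Quotient.mk J z} ≃+* S ⧸ (J ⊔ Ideal.span {z}) :=
    (Ideal.quotEquivOfEq heq).trans (DoubleQuot.quotQuotEquivQuotSup J (Ideal.span {z}))
  rwa [ringKrullDim_eq_of_ringEquiv e] at h

/-- The colon by the whole ring is the ideal itself. [folklore] -/
theorem colon_coe_top_eq {S : Type*} [CommRing S] (N : Ideal S) :
    Submodule.colon N ((⊤ : Ideal S) : Set S) = N := by
  ext y
  rw [Submodule.mem_colon]
  constructor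
  · intro h
    simpa using h 1 trivial
  · intro hy p _
    rw [smul_eq_mul]
    exact N.mul_mem_right p hy

/-- `y ∈ (N : (t)ⁿ) ↔ y tⁿ ∈ N`. [folklore] -/
theorem mem_colon_span_singleton_pow_iff {S : Type*} [CommRing S] (N : Ideal S) (t : S) (n : ℕ)
    (y : S) : y ∈ Submodule.colon N ((Ideal.span {t} ^ n : Ideal S) : Set S) ↔ y * t ^ n ∈ N := by
  rw [Ideal.span_singleton_pow, Submodule.mem_colon]
  constructor
  · intro h
    have := h (t ^ n) (Ideal.mem_span_singleton_self _)
    rwa [smul_eq_mul] at this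
  · intro h p hp
    obtain ⟨c, rfl⟩ := Ideal.mem_span_singleton'.mp hp
    rw [smul_eq_mul, show y * (c * t ^ n) = c * (y * t ^ n) by ring]
    exact N.mul_mem_left c h

/-- **Swapping a regular sequence of length two**: if `t` is a nonzerodivisor and `c` is a
nonzerodivisor modulo `t`, then `t` is a nonzerodivisor modulo `c`. [folklore] -/
theorem mem_span_singleton_of_mul_mem_of_swap {S : Type*} [CommRing S] {t c : S}
    (ht : t ∈ nonZeroDivisors S) (hc : ∀ y : S, c * y ∈ Ideal.span {t} → y ∈ Ideal.span {t})
    {y : S} (hy : t * y ∈ Ideal.span {c}) : y ∈ Ideal.span {c} := by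
  obtain ⟨s, hs⟩ := Ideal.mem_span_singleton'.mp hy
  -- `c s ∈ (t)`, so `s = s' t`
  have hcs : c * s ∈ Ideal.span {t} := Ideal.mem_span_singleton'.mpr ⟨y, by rw [mul_comm y t, ← hs, mul_comm]⟩
  obtain ⟨s', hs'⟩ := Ideal.mem_span_singleton'.mp (hc s hcs)
  refine Ideal.mem_span_singleton'.mpr ⟨s', ?_⟩
  apply (mul_cancel_left_mem_nonZeroDivisors ht).mp
  rw [← hs, ← hs']
  ring

/-- **The saturation of `(c)` by a nonzerodivisor modulo `(c)` is `(c)`**: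
`⋃ₙ ((c) : tⁿ) = (c)` if `t y ∈ (c) ⇒ y ∈ (c)`. [folklore] -/
theorem iSup_colon_span_singleton_pow_eq_of_regular {S : Type*} [CommRing S] {t c : S}
    (h : ∀ y : S, t * y ∈ Ideal.span {c} → y ∈ Ideal.span {c}) :
    ⨆ n : ℕ, Submodule.colon (Ideal.span {c}) ((Ideal.span {t} ^ n : Ideal S) : Set S) =
      Ideal.span {c} := by
  apply le_antisymm
  · refine iSup_le fun n => ?_
    intro y hy
    rw [mem_colon_span_singleton_pow_iff] at hy
    induction n generalizing y with
    | zero => simpa using hy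
    | succ n ih =>
      refine ih (h _ ?_)
      rw [show t * (y * t ^ n) = y * t ^ (n + 1) by ring]
      exact hy
  · refine le_iSup_of_le 0 ?_
    intro y hy
    rw [mem_colon_span_singleton_pow_iff, pow_zero, mul_one]
    exact hy

/-- `((t c) : tⁿ⁺¹) = ((c) : tⁿ)` for a nonzerodivisor `t`. [folklore] -/
theorem colon_span_singleton_mul_pow_succ {S : Type*} [CommRing S] {t : S}
    (ht : t ∈ nonZeroDivisors S) (c : S) (n : ℕ) :
    Submodule.colon (Ideal.span {t * c}) ((Ideal.span {t} ^ (n + 1) : Ideal S) : Set S) =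
      Submodule.colon (Ideal.span {c}) ((Ideal.span {t} ^ n : Ideal S) : Set S) := by
  ext y
  rw [mem_colon_span_singleton_pow_iff, mem_colon_span_singleton_pow_iff,
    Ideal.mem_span_singleton', Ideal.mem_span_singleton']
  constructor
  · rintro ⟨s, hs⟩
    refine ⟨s, (mul_cancel_left_mem_nonZeroDivisors ht).mp ?_⟩
    rw [show t * (s * c) = s * (t * c) by ring, hs]
    ring
  · rintro ⟨s, hs⟩
    exact ⟨s, by rw [show s * (t * c) = t * (s * c) by ring, hs]; ring⟩

/-- **The saturation of `(t c)` by `t` is `(c)`** when `t` is a nonzerodivisor which stays a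
nonzerodivisor modulo `c`: `⋃ₙ ((t c) : tⁿ) = (c)`. [folklore] -/
theorem iSup_colon_span_singleton_mul_pow_eq {S : Type*} [CommRing S] {t c : S}
    (ht : t ∈ nonZeroDivisors S) (h : ∀ y : S, t * y ∈ Ideal.span {c} → y ∈ Ideal.span {c}) :
    ⨆ n : ℕ, Submodule.colon (Ideal.span {t * c}) ((Ideal.span {t} ^ n : Ideal S) : Set S) =
      Ideal.span {c} := by
  rw [← iSup_colon_span_singleton_pow_eq_of_regular h]
  apply le_antisymm
  · refine iSup_le fun n => ?_
    cases n with
    | zero =>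
      refine le_iSup_of_le 0 ?_
      intro y hy
      rw [mem_colon_span_singleton_pow_iff, pow_zero, mul_one] at hy ⊢
      obtain ⟨s, rfl⟩ := Ideal.mem_span_singleton'.mp hy
      exact Ideal.mem_span_singleton'.mpr ⟨s * t, by ring⟩
    | succ n =>
      rw [colon_span_singleton_mul_pow_succ ht c n]
      exact le_iSup (fun n => Submodule.colon (Ideal.span {c}) ((Ideal.span {t} ^ n : Ideal S) : Set S)) n
  · refine iSup_le fun n => le_iSup_of_le (n + 1) ?_
    rw [colon_span_singleton_mul_pow_succ ht c n]

/-- **The saturation of `(t)` by `t` is the unit ideal.** [folklore] -/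
theorem iSup_colon_span_singleton_self_pow_eq_top {S : Type*} [CommRing S] (t : S) :
    ⨆ n : ℕ, Submodule.colon (Ideal.span {t}) ((Ideal.span {t} ^ n : Ideal S) : Set S) = ⊤ := by
  rw [eq_top_iff]
  refine le_iSup_of_le 1 ?_
  intro y _
  rw [mem_colon_span_singleton_pow_iff, pow_one]
  exact Ideal.mem_span_singleton'.mpr ⟨y, rfl⟩

end Generic

/-! ## The local rings of a chart over the centre -/

section Chart

variable {R : Type u} [CommRing R] {r : ℕ} (x : Fin r → R) (i : Fin r)

local notation3 "I" => Ideal.span (Set.range x)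
local notation3 "B" => HomogeneousLocalization.Away (reesGrading I)
  (reesT (x i) (Ideal.mem_span_range_self (f := x) (x := i)))
local notation3 "φ" => reesChartBase (x i) (Ideal.mem_span_range_self (f := x) (x := i))
local notation3 "e[" j "]" =>
  HomogeneousLocalization.Away.mk (reesGrading I)
    (reesT_mem (x i) (Ideal.mem_span_range_self (f := x) (x := i))) 1
    (reesT (x j) (Ideal.mem_span_range_self (f := x) (x := j))) (reesT_mem_one_smul x j)

variable (K : Ideal R) (T : Set (Fin r))
variable {A : Type u} [CommRing A] [Algebra R A] (𝔭 : Ideal R) [𝔭.IsPrime]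
  [IsLocalization.AtPrime A 𝔭]

omit [𝔭.IsPrime] in
/-- The stage ideal lies in a prime `Q` over `𝔭 ⊇ K` containing `x_i` and the `e_j`, `j ∈ T`.
[folklore] -/
theorem chartStageIdeal_le (Q : Ideal B) (hT : ∀ j ∈ T, e[j] ∈ Q) (hxi : φ (x i) ∈ Q)
    (hQ : ∀ s : R, φ s ∈ Q ↔ s ∈ 𝔭) (hK : K ≤ 𝔭) : chartStageIdeal x i K T ≤ Q := by
  refine sup_le (sup_le ?_ ?_) ?_
  · rwa [Ideal.span_singleton_le_iff_mem]
  · rw [Ideal.map_le_iff_le_comap]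
    exact fun k hk => (hQ k).mpr (hK hk)
  · rw [Ideal.span_le]
    rintro _ ⟨j, hj, rfl⟩
    exact hT j hj

/-- The prime `𝔔₀(Q) ⊆ (R/(I + K))[T_j : j ≠ i, j ∉ T]` corresponding to `Q/J(K, T)` along
`chartStageEquiv`. [folklore] -/
def chartStagePrime (hx : IsQuasiRegular x) (hiT : i ∉ T) (Q : Ideal B) :
    Ideal (MvPolynomial {j : Fin r // j ≠ i ∧ j ∉ T} (R ⧸ (I ⊔ K))) :=
  (Q.map (Ideal.Quotient.mk (chartStageIdeal x i K T))).comap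
    (chartStageEquiv x i K T hx hiT).toRingHom

/-- For `J(K, T) ⊆ Q`: `mk b ∈ Q/J ↔ b ∈ Q`. [folklore] -/
theorem mk_mem_map_chartStageIdeal_iff {Q : Ideal B} (hJQ : chartStageIdeal x i K T ≤ Q) (b : B) :
    Ideal.Quotient.mk (chartStageIdeal x i K T) b ∈
      Q.map (Ideal.Quotient.mk (chartStageIdeal x i K T)) ↔ b ∈ Q := by
  constructor
  · intro h
    obtain ⟨b', hb', hbb'⟩ :=
      (Ideal.mem_map_iff_of_surjective _ Ideal.Quotient.mk_surjective).mp h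
    rw [Ideal.Quotient.eq] at hbb'
    have : b = b' - (b' - b) := by ring
    rw [this]
    exact Q.sub_mem hb' (hJQ hbb')
  · exact fun h => Ideal.mem_map_of_mem _ h

/-- Membership in `𝔔₀(Q)` along `chartStageEquiv⁻¹`. [folklore] -/
theorem symm_mem_chartStagePrime_iff (hx : IsQuasiRegular x) (hiT : i ∉ T) {Q : Ideal B}
    (hJQ : chartStageIdeal x i K T ≤ Q) (b : B) :
    (chartStageEquiv x i K T hx hiT).symm (Ideal.Quotient.mk _ b) ∈ chartStagePrime x i K T hx hiT Q ↔
      b ∈ Q := by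
  rw [chartStagePrime, Ideal.mem_comap, RingEquiv.toRingHom_eq_coe, RingHom.coe_coe,
    RingEquiv.apply_symm_apply, mk_mem_map_chartStageIdeal_iff x i K T hJQ]

/-- Constants in `𝔔₀(Q)`: `s̄ ∈ 𝔔₀ ↔ φ(s) ∈ Q`. [folklore] -/
theorem C_mem_chartStagePrime_iff (hx : IsQuasiRegular x) (hiT : i ∉ T) {Q : Ideal B}
    (hJQ : chartStageIdeal x i K T ≤ Q) (s : R) :
    MvPolynomial.C (Ideal.Quotient.mk (I ⊔ K) s) ∈ chartStagePrime x i K T hx hiT Q ↔ φ s ∈ Q := by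
  have h1 : (chartStageEquiv x i K T hx hiT).symm (Ideal.Quotient.mk (chartStageIdeal x i K T) (φ s)) =
      MvPolynomial.C (Ideal.Quotient.mk (I ⊔ K) s) := by
    rw [RingEquiv.symm_apply_eq, chartStageEquiv_C]
  rw [← symm_mem_chartStagePrime_iff x i K T hx hiT hJQ, h1]

/-- Variables in `𝔔₀(Q)`: `T_j ∈ 𝔔₀ ↔ e_j ∈ Q`. [folklore] -/
theorem X_mem_chartStagePrime_iff (hx : IsQuasiRegular x) (hiT : i ∉ T) {Q : Ideal B}
    (hJQ : chartStageIdeal x i K T ≤ Q) (j : {j : Fin r // j ≠ i ∧ j ∉ T}) :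
    MvPolynomial.X j ∈ chartStagePrime x i K T hx hiT Q ↔ e[j.1] ∈ Q := by
  have h1 : (chartStageEquiv x i K T hx hiT).symm (Ideal.Quotient.mk (chartStageIdeal x i K T) e[j.1]) =
      MvPolynomial.X j := by
    rw [RingEquiv.symm_apply_eq, chartStageEquiv_X]
  rw [← symm_mem_chartStagePrime_iff x i K T hx hiT hJQ, h1]

/-- `𝔔₀(Q)` is prime for `J(K, T) ⊆ Q` prime. [folklore] -/
theorem chartStagePrime_isPrime (hx : IsQuasiRegular x) (hiT : i ∉ T) (Q : Ideal B) [Q.IsPrime]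
    (hJQ : chartStageIdeal x i K T ≤ Q) : (chartStagePrime x i K T hx hiT Q).IsPrime := by
  haveI : (Q.map (Ideal.Quotient.mk (chartStageIdeal x i K T))).IsPrime :=
    Ideal.map_isPrime_of_surjective Ideal.Quotient.mk_surjective (by rwa [Ideal.mk_ker])
  exact Ideal.comap_isPrime _ _

/-- The `(R/(I + K))[T_j : j ≠ i, j ∉ T]`-algebra structure on `S/J(K, T)S` through
`chartStageEquiv : (R/(I + K))[T] ≅ B/J(K, T)` and `B/J → S/JS`. [folklore] -/
@[reducible] def chartStageAlgebra (hx : IsQuasiRegular x) (hiT : i ∉ T) (S : Type u) [CommRing S]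
    [Algebra B S] :
    Algebra (MvPolynomial {j : Fin r // j ≠ i ∧ j ∉ T} (R ⧸ (I ⊔ K)))
      (S ⧸ (chartStageIdeal x i K T).map (algebraMap B S : B →+* S)) :=
  ((algebraMap (B ⧸ chartStageIdeal x i K T)
    (S ⧸ (chartStageIdeal x i K T).map (algebraMap B S : B →+* S))).comp
      (chartStageEquiv x i K T hx hiT).toRingHom).toAlgebra

/-- Unfolding `chartStageAlgebra`. [folklore] -/
theorem chartStageAlgebra_algebraMap_apply (hx : IsQuasiRegular x) (hiT : i ∉ T) (S : Type u)
    [CommRing S] [Algebra B S] (t : MvPolynomial {j : Fin r // j ≠ i ∧ j ∉ T} (R ⧸ (I ⊔ K))) :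
    letI := chartStageAlgebra x i K T hx hiT S
    algebraMap (MvPolynomial {j : Fin r // j ≠ i ∧ j ∉ T} (R ⧸ (I ⊔ K)))
      (S ⧸ (chartStageIdeal x i K T).map (algebraMap B S : B →+* S)) t =
      algebraMap (B ⧸ chartStageIdeal x i K T) _ (chartStageEquiv x i K T hx hiT t) := rfl

/-- `φ(s)` in `S/JS` is the image of the constant `s̄`. [folklore] -/
theorem chartStageAlgebra_algebraMap_C (hx : IsQuasiRegular x) (hiT : i ∉ T) (S : Type u)
    [CommRing S] [Algebra B S] (s : R) :
    letI := chartStageAlgebra x i K T hx hiT S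
    algebraMap (MvPolynomial {j : Fin r // j ≠ i ∧ j ∉ T} (R ⧸ (I ⊔ K)))
      (S ⧸ (chartStageIdeal x i K T).map (algebraMap B S : B →+* S))
        (MvPolynomial.C (Ideal.Quotient.mk (I ⊔ K) s)) =
      Ideal.Quotient.mk _ ((algebraMap B S : B →+* S) (φ s)) := by
  rw [chartStageAlgebra_algebraMap_apply, chartStageEquiv_C]
  rfl

/-- `e_j` in `S/JS` is the image of the variable `T_j`. [folklore] -/
theorem chartStageAlgebra_algebraMap_X (hx : IsQuasiRegular x) (hiT : i ∉ T) (S : Type u)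
    [CommRing S] [Algebra B S] (j : {j : Fin r // j ≠ i ∧ j ∉ T}) :
    letI := chartStageAlgebra x i K T hx hiT S
    algebraMap (MvPolynomial {j : Fin r // j ≠ i ∧ j ∉ T} (R ⧸ (I ⊔ K)))
      (S ⧸ (chartStageIdeal x i K T).map (algebraMap B S : B →+* S)) (MvPolynomial.X j) =
      Ideal.Quotient.mk _ ((algebraMap B S : B →+* S) e[j.1]) := by
  rw [chartStageAlgebra_algebraMap_apply, chartStageEquiv_X]
  rfl

/-- **`S/J(K, T)S` is the localization of `(R/(I + K))[T_j : j ≠ i, j ∉ T]` at `𝔔₀(Q)`** for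
`S = B_Q`, `J(K, T) ⊆ Q`. [folklore] -/
theorem isLocalization_atPrime_chartStage (hx : IsQuasiRegular x) (hiT : i ∉ T) (Q : Ideal B)
    [Q.IsPrime] (S : Type u) [CommRing S] [Algebra B S] [IsLocalization.AtPrime S Q]
    (hJQ : chartStageIdeal x i K T ≤ Q) :
    @IsLocalization.AtPrime _ _ (S ⧸ (chartStageIdeal x i K T).map (algebraMap B S : B →+* S)) _
      (chartStageAlgebra x i K T hx hiT S) (chartStagePrime x i K T hx hiT Q)
      (chartStagePrime_isPrime x i K T hx hiT Q hJQ) :=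
  @isLocalization_atPrime_quotient_of_ringEquiv B S _ _ _ _ _ Q _ _ (chartStageIdeal x i K T)
    (chartStageEquiv x i K T hx hiT) (chartStagePrime x i K T hx hiT Q)
    (chartStagePrime_isPrime x i K T hx hiT Q hJQ)
    (symm_mem_chartStagePrime_iff x i K T hx hiT hJQ)

/-- **The local ring of the chart modulo a stage ideal is a localization of a polynomial ring
over a quotient of the regular local ring downstairs**: with `S = B_Q` (`Q` over `𝔭`, on the
exceptional divisor), `A = R_𝔭`, `J = J(K, T)` (`K ⊆ 𝔭`, `e_j ∈ Q` for `j ∈ T ∌ i`), there is a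
prime `𝔔` of `(A/(I + K)A)[T_j : j ≠ i, j ∉ T]` and an isomorphism
`S/JS ≅ ((A/(I + K)A)[T_j : j ≠ i, j ∉ T])_𝔔` sending `φ(s) ↦ s̄` and `e_j ↦ T_j`
(`chartStageEquiv` localized: `S/JS = (B/J)_Q`, `B/J ≅ (R/(I+K))[T]`, and
`(A/(I+K)A)[T]` is a localization of `(R/(I+K))[T]` at elements outside the prime).
[cite: StacksProject, Tag 0BIQ] -/
theorem exists_equiv_quotient_chartStageIdeal (hx : IsQuasiRegular x) (hiT : i ∉ T)
    (Q : Ideal B) [Q.IsPrime] (S : Type u) [CommRing S] [Algebra B S] [IsLocalization.AtPrime S Q]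
    (hT : ∀ j ∈ T, e[j] ∈ Q) (hxi : φ (x i) ∈ Q) (hQ : ∀ s : R, φ s ∈ Q ↔ s ∈ 𝔭) (hK : K ≤ 𝔭) :
    ∃ (𝔔 : PrimeSpectrum (MvPolynomial {j : Fin r // j ≠ i ∧ j ∉ T}
        (A ⧸ (I ⊔ K).map (algebraMap R A))))
      (θ : (S ⧸ (chartStageIdeal x i K T).map (algebraMap B S : B →+* S)) ≃+*
        Localization.AtPrime 𝔔.asIdeal),
      (∀ s : R, θ (Ideal.Quotient.mk _ ((algebraMap B S : B →+* S) (φ s))) =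
          algebraMap (MvPolynomial {j : Fin r // j ≠ i ∧ j ∉ T} (A ⧸ (I ⊔ K).map (algebraMap R A)))
            (Localization.AtPrime 𝔔.asIdeal)
            (MvPolynomial.C (Ideal.Quotient.mk _ (algebraMap R A s)))) ∧
      (∀ j : {j : Fin r // j ≠ i ∧ j ∉ T}, θ (Ideal.Quotient.mk _ ((algebraMap B S : B →+* S) e[j.1])) =
          algebraMap (MvPolynomial {j : Fin r // j ≠ i ∧ j ∉ T} (A ⧸ (I ⊔ K).map (algebraMap R A)))
            (Localization.AtPrime 𝔔.asIdeal) (MvPolynomial.X j)) := by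
  have hJQ : chartStageIdeal x i K T ≤ Q := chartStageIdeal_le x i K T 𝔭 Q hT hxi hQ hK
  haveI h𝔔₀prime := chartStagePrime_isPrime x i K T hx hiT Q hJQ
  letI algT₀ := chartStageAlgebra x i K T hx hiT S
  haveI hloc := isLocalization_atPrime_chartStage x i K T hx hiT Q S hJQ
  -- `T₁ = (A/(I+K)A)[T]` is the localization of `T₀` at `C(R ∖ 𝔭)`
  letI algT₁ : Algebra (MvPolynomial {j : Fin r // j ≠ i ∧ j ∉ T} (R ⧸ (I ⊔ K)))
      (MvPolynomial {j : Fin r // j ≠ i ∧ j ∉ T} (A ⧸ (I ⊔ K).map (algebraMap R A))) :=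
    MvPolynomial.algebraMvPolynomial
  haveI hloc₁ : IsLocalization ((Algebra.algebraMapSubmonoid (R ⧸ (I ⊔ K)) 𝔭.primeCompl).map
      (MvPolynomial.C : R ⧸ (I ⊔ K) →+* MvPolynomial {j : Fin r // j ≠ i ∧ j ∉ T} (R ⧸ (I ⊔ K))))
      (MvPolynomial {j : Fin r // j ≠ i ∧ j ∉ T} (A ⧸ (I ⊔ K).map (algebraMap R A))) :=
    MvPolynomial.isLocalization _ _
  have hdisj : Disjoint (((Algebra.algebraMapSubmonoid (R ⧸ (I ⊔ K)) 𝔭.primeCompl).map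
      (MvPolynomial.C : R ⧸ (I ⊔ K) →+* MvPolynomial {j : Fin r // j ≠ i ∧ j ∉ T} (R ⧸ (I ⊔ K))) :
        Submonoid _) : Set _)
      (chartStagePrime x i K T hx hiT Q :
        Set (MvPolynomial {j : Fin r // j ≠ i ∧ j ∉ T} (R ⧸ (I ⊔ K)))) := by
    rw [Set.disjoint_left]
    rintro _ ⟨_, ⟨s, hs, rfl⟩, rfl⟩ hmem
    exact hs ((hQ s).mp ((C_mem_chartStagePrime_iff x i K T hx hiT hJQ s).mp hmem))
  obtain ⟨𝔔₁, -, -, ⟨θ₀⟩⟩ := exists_algEquiv_localization_atPrime_map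
    (T₁ := MvPolynomial {j : Fin r // j ≠ i ∧ j ∉ T} (A ⧸ (I ⊔ K).map (algebraMap R A)))
    (Sb := S ⧸ (chartStageIdeal x i K T).map (algebraMap B S : B →+* S))
    (chartStagePrime x i K T hx hiT Q) _ hdisj
  refine ⟨𝔔₁, θ₀.toRingEquiv, fun s => ?_, fun j => ?_⟩
  · change θ₀ _ = _
    rw [← chartStageAlgebra_algebraMap_C x i K T hx hiT S s, AlgEquiv.commutes,
      IsScalarTower.algebraMap_apply _
        (MvPolynomial {j : Fin r // j ≠ i ∧ j ∉ T} (A ⧸ (I ⊔ K).map (algebraMap R A))) _,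
      MvPolynomial.algebraMap_def, MvPolynomial.map_C]
    rfl
  · change θ₀ _ = _
    rw [← chartStageAlgebra_algebraMap_X x i K T hx hiT S j, AlgEquiv.commutes,
      IsScalarTower.algebraMap_apply _
        (MvPolynomial {j : Fin r // j ≠ i ∧ j ∉ T} (A ⧸ (I ⊔ K).map (algebraMap R A))) _,
      MvPolynomial.algebraMap_def, MvPolynomial.map_X]

/-- **The quotients `S/J(K, T)S` are domains** when `A/(I + K)A` is. [folklore] -/
theorem isDomain_quotient_map_chartStageIdeal (hx : IsQuasiRegular x) (hiT : i ∉ T)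
    (Q : Ideal B) [Q.IsPrime] (S : Type u) [CommRing S] [Algebra B S] [IsLocalization.AtPrime S Q]
    (hT : ∀ j ∈ T, e[j] ∈ Q) (hxi : φ (x i) ∈ Q) (hQ : ∀ s : R, φ s ∈ Q ↔ s ∈ 𝔭) (hK : K ≤ 𝔭)
    [IsDomain (A ⧸ (I ⊔ K).map (algebraMap R A))] :
    IsDomain (S ⧸ (chartStageIdeal x i K T).map (algebraMap B S : B →+* S)) := by
  obtain ⟨𝔔, θ, -, -⟩ := exists_equiv_quotient_chartStageIdeal (A := A) x i K T 𝔭 hx hiT Q S hT hxi hQ hK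
  exact Function.Injective.isDomain θ.toRingHom θ.injective

/-- **In `S/J(K, T)S` the image of `φ(s)` is nonzero** whenever `s̄ ≠ 0` in `A/(I + K)A` (a domain).
[folklore] -/
theorem mk_algebraMap_reesChartBase_ne_zero (hx : IsQuasiRegular x) (hiT : i ∉ T)
    (Q : Ideal B) [Q.IsPrime] (S : Type u) [CommRing S] [Algebra B S] [IsLocalization.AtPrime S Q]
    (hT : ∀ j ∈ T, e[j] ∈ Q) (hxi : φ (x i) ∈ Q) (hQ : ∀ s : R, φ s ∈ Q ↔ s ∈ 𝔭) (hK : K ≤ 𝔭)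
    [IsDomain (A ⧸ (I ⊔ K).map (algebraMap R A))] {s : R}
    (hs : Ideal.Quotient.mk ((I ⊔ K).map (algebraMap R A)) (algebraMap R A s) ≠ 0) :
    Ideal.Quotient.mk ((chartStageIdeal x i K T).map (algebraMap B S : B →+* S))
      ((algebraMap B S : B →+* S) (φ s)) ≠ 0 := by
  obtain ⟨𝔔, θ, hθC, -⟩ := exists_equiv_quotient_chartStageIdeal (A := A) x i K T 𝔭 hx hiT Q S hT hxi hQ hK
  intro h0
  have h1 := hθC s
  rw [h0, map_zero] at h1
  have hinj : Function.Injective (algebraMap (MvPolynomial {j : Fin r // j ≠ i ∧ j ∉ T}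
      (A ⧸ (I ⊔ K).map (algebraMap R A))) (Localization.AtPrime 𝔔.asIdeal)) :=
    IsLocalization.injective (Localization.AtPrime 𝔔.asIdeal) 𝔔.asIdeal.primeCompl_le_nonZeroDivisors
  have h2 : (MvPolynomial.C (Ideal.Quotient.mk ((I ⊔ K).map (algebraMap R A)) (algebraMap R A s)) :
      MvPolynomial {j : Fin r // j ≠ i ∧ j ∉ T} (A ⧸ (I ⊔ K).map (algebraMap R A))) = 0 :=
    hinj (by rw [map_zero]; exact h1.symm)
  exact hs (MvPolynomial.C_injective _ _ (by rw [h2, MvPolynomial.C_0]))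

/-- **In `S/J(K, T)S` the chart generators `e_j`, `j ≠ i`, `j ∉ T`, are nonzero** (`A/(I + K)A`
a domain). [folklore] -/
theorem mk_algebraMap_chartGen_ne_zero (hx : IsQuasiRegular x) (hiT : i ∉ T)
    (Q : Ideal B) [Q.IsPrime] (S : Type u) [CommRing S] [Algebra B S] [IsLocalization.AtPrime S Q]
    (hT : ∀ j ∈ T, e[j] ∈ Q) (hxi : φ (x i) ∈ Q) (hQ : ∀ s : R, φ s ∈ Q ↔ s ∈ 𝔭) (hK : K ≤ 𝔭)
    [IsDomain (A ⧸ (I ⊔ K).map (algebraMap R A))] (j : {j : Fin r // j ≠ i ∧ j ∉ T}) :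
    Ideal.Quotient.mk ((chartStageIdeal x i K T).map (algebraMap B S : B →+* S))
      ((algebraMap B S : B →+* S) e[j.1]) ≠ 0 := by
  obtain ⟨𝔔, θ, -, hθX⟩ := exists_equiv_quotient_chartStageIdeal (A := A) x i K T 𝔭 hx hiT Q S hT hxi hQ hK
  intro h0
  have h1 := hθX j
  rw [h0, map_zero] at h1
  have hinj : Function.Injective (algebraMap (MvPolynomial {j : Fin r // j ≠ i ∧ j ∉ T}
      (A ⧸ (I ⊔ K).map (algebraMap R A))) (Localization.AtPrime 𝔔.asIdeal)) :=
    IsLocalization.injective (Localization.AtPrime 𝔔.asIdeal) 𝔔.asIdeal.primeCompl_le_nonZeroDivisors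
  exact MvPolynomial.X_ne_zero j (hinj (by rw [map_zero]; exact h1.symm))

/-- **`S/J(K, T)S` is a regular local ring** when `A/(I + K)A` is a regular ring (e.g. the residue
field, `K = (w)`): it is a localization of a polynomial ring over a regular ring. [folklore] -/
theorem isRegularLocalRing_quotient_map_chartStageIdeal (hx : IsQuasiRegular x) (hiT : i ∉ T)
    (Q : Ideal B) [Q.IsPrime] (S : Type u) [CommRing S] [Algebra B S] [IsLocalization.AtPrime S Q]
    (hT : ∀ j ∈ T, e[j] ∈ Q) (hxi : φ (x i) ∈ Q) (hQ : ∀ s : R, φ s ∈ Q ↔ s ∈ 𝔭) (hK : K ≤ 𝔭)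
    [IsRegularRing (A ⧸ (I ⊔ K).map (algebraMap R A))] :
    IsRegularLocalRing (S ⧸ (chartStageIdeal x i K T).map (algebraMap B S : B →+* S)) := by
  obtain ⟨𝔔, θ, -, -⟩ := exists_equiv_quotient_chartStageIdeal (A := A) x i K T 𝔭 hx hiT Q S hT hxi hQ hK
  haveI : IsRegularLocalRing (Localization.AtPrime 𝔔.asIdeal) :=
    IsRegularRing.isRegularLocalRing_localization _
  exact IsRegularLocalRing.of_ringEquiv (R := Localization.AtPrime 𝔔.asIdeal) θ.symm

omit [𝔭.IsPrime] [IsLocalization.AtPrime A 𝔭] in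
/-- In any `B`-algebra the images of the `x_j` generate the principal ideal of `x_i`
(`I·B = (φ x_i)`). [cite: StacksProject, Tag 0804] -/
theorem span_range_algebraMap_reesChartBase_x (S : Type*) [CommRing S] [Algebra B S] :
    Ideal.span (Set.range fun j : Fin r => (algebraMap B S : B →+* S) (φ (x j))) =
      Ideal.span {(algebraMap B S : B →+* S) (φ (x i))} := by
  have hI : Ideal.map φ I = Ideal.span {φ (x i)} :=
    span_image_reesChartBase_eq (x i) (Ideal.mem_span_range_self (f := x) (x := i))
  have h := congrArg (Ideal.map (algebraMap B S : B →+* S)) hI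
  rw [Ideal.map_map, Ideal.map_span, Ideal.map_span, Set.image_singleton, ← Set.range_comp] at h
  exact h

/-! ## Adding one equation at a time -/

omit [𝔭.IsPrime] in
/-- One more base equation: `J(K + (c), T) = J(K, T) + (φ c)`. [folklore] -/
theorem chartStageIdeal_sup_span_singleton (c : R) :
    chartStageIdeal x i (K ⊔ Ideal.span {c}) T = chartStageIdeal x i K T ⊔ Ideal.span {φ c} := by
  rw [chartStageIdeal, chartStageIdeal, Ideal.map_sup, Ideal.map_span, Set.image_singleton]
  simp only [sup_assoc]
  congr 2
  exact sup_comm _ _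

omit [𝔭.IsPrime] in
/-- One more chart generator: `J(K, T ∪ {j}) = J(K, T) + (e_j)`. [folklore] -/
theorem chartStageIdeal_insert (j : Fin r) :
    chartStageIdeal x i K (insert j T) = chartStageIdeal x i K T ⊔ Ideal.span {e[j]} := by
  rw [chartStageIdeal, chartStageIdeal, Set.image_insert_eq, Ideal.span_insert]
  simp only [sup_assoc]
  congr 2
  exact sup_comm _ _

/-! ## The regular system of parameters upstairs -/

section Rsop

variable {a : ℕ} (w : Fin a → R)

/-- The base equations `(w_m : m ∈ W)`. [folklore] -/
def wIdeal (W : Set (Fin a)) : Ideal R := Ideal.span (w '' W)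

/-- The regular system of parameters `(x, w)` of `A = R_𝔭` (as a family `Fin (r + a) → A`). -/
local notation3 "uA" => Fin.append (fun j : Fin r => algebraMap R A (x j))
  (fun m : Fin a => algebraMap R A (w m))

omit [𝔭.IsPrime] [IsLocalization.AtPrime A 𝔭] in
/-- `(I + (w_W)) A = (u_l : l ∈ castAdd(univ) ∪ natAdd(W))` for `u = (x, w)`. [folklore] -/
theorem map_sup_wIdeal_eq (W : Set (Fin a)) :
    (I ⊔ wIdeal w W).map (algebraMap R A) =
      Ideal.span (uA '' (Set.range (Fin.castAdd a) ∪ Fin.natAdd r '' W)) := by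
  rw [wIdeal, Ideal.map_sup, Ideal.map_span, Ideal.map_span, ← Ideal.span_union]
  congr 1
  ext y
  constructor
  · rintro (⟨_, ⟨j, rfl⟩, rfl⟩ | ⟨_, ⟨m, hm, rfl⟩, rfl⟩)
    · exact ⟨Fin.castAdd a j, Or.inl ⟨j, rfl⟩, by rw [Fin.append_left]⟩
    · exact ⟨Fin.natAdd r m, Or.inr ⟨m, hm, rfl⟩, by rw [Fin.append_right]⟩
  · rintro ⟨_, (⟨j, rfl⟩ | ⟨m, hm, rfl⟩), rfl⟩
    · exact Or.inl ⟨x j, ⟨j, rfl⟩, by rw [Fin.append_left]⟩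
    · exact Or.inr ⟨w m, ⟨m, hm, rfl⟩, by rw [Fin.append_right]⟩

variable [IsRegularLocalRing A] (hd : (maximalIdeal A).spanFinrank = r + a)
  (hu : Ideal.span (Set.range (Fin.append (fun j : Fin r => algebraMap R A (x j))
    (fun m : Fin a => algebraMap R A (w m)))) = maximalIdeal A)

omit [𝔭.IsPrime] [IsLocalization.AtPrime A 𝔭] in
include hd hu in
/-- `(I + (w_W)) A` is a prime ideal of `A` (generated by part of the regular system of parameters
`(x, w)`). [cite: Matsumura1987, Thm. 14.2, 14.3] -/
theorem isPrime_map_sup_wIdeal (W : Set (Fin a)) : ((I ⊔ wIdeal w W).map (algebraMap R A)).IsPrime := by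
  classical
  rw [map_sup_wIdeal_eq x w W]
  obtain ⟨F, hF⟩ : ∃ F : Finset (Fin (r + a)),
      (F : Set (Fin (r + a))) = Set.range (Fin.castAdd a) ∪ Fin.natAdd r '' W :=
    ⟨(Set.toFinite _).toFinset, Set.Finite.coe_toFinset _⟩
  rw [← hF]
  exact isPrime_span_image hd _ hu F

omit [𝔭.IsPrime] [IsLocalization.AtPrime A 𝔭] in
include hd hu in
/-- `A/(I + (w_W)) A` is a domain. [cite: Matsumura1987, Thm. 14.3] -/
theorem isDomain_quotient_map_sup_wIdeal (W : Set (Fin a)) :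
    IsDomain (A ⧸ (I ⊔ wIdeal w W).map (algebraMap R A)) :=
  haveI := isPrime_map_sup_wIdeal x w hd hu W
  (Ideal.Quotient.isDomain_iff_prime _).mpr inferInstance

omit [𝔭.IsPrime] [IsLocalization.AtPrime A 𝔭] in
include hd hu in
/-- `w_m ≠ 0` in `A/(I + (w_W)) A` for `m ∉ W` (minimality of the regular system of parameters).
[cite: Matsumura1987, Thm. 14.2] -/
theorem mk_algebraMap_w_ne_zero {W : Set (Fin a)} {m : Fin a} (hm : m ∉ W) :
    Ideal.Quotient.mk ((I ⊔ wIdeal w W).map (algebraMap R A)) (algebraMap R A (w m)) ≠ 0 := by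
  rw [Ne, Ideal.Quotient.eq_zero_iff_mem, map_sup_wIdeal_eq x w W]
  have h := not_mem_span_image_of_not_mem hd _ hu
    (S := Set.range (Fin.castAdd a) ∪ Fin.natAdd r '' W) (i := Fin.natAdd r m) ?_
  · rwa [Fin.append_right] at h
  · rintro (⟨j, hj⟩ | ⟨m', hm', hmm'⟩)
    · exact absurd (congrArg Fin.val hj) (by simp; omega)
    · exact hm ((Fin.natAdd_inj r).mp hmm' ▸ hm')

omit [𝔭.IsPrime] [IsLocalization.AtPrime A 𝔭] in
include hu in
/-- With all the `w_m` the ideal `(I + (w)) A` is the maximal ideal, and the quotient (the residue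
field) is a regular ring. [folklore] -/
theorem isRegularRing_quotient_map_sup_wIdeal {W : Set (Fin a)} (hW : ∀ m, m ∈ W) :
    IsRegularRing (A ⧸ (I ⊔ wIdeal w W).map (algebraMap R A)) := by
  have hmax : (I ⊔ wIdeal w W).map (algebraMap R A) = maximalIdeal A := by
    rw [map_sup_wIdeal_eq x w W, ← hu]
    congr 1
    apply Set.Subset.antisymm (Set.image_subset_range _ _)
    rintro _ ⟨l, rfl⟩
    refine ⟨l, ?_, rfl⟩
    induction l using Fin.addCases with
    | left j => exact Or.inl ⟨j, rfl⟩
    | right m => exact Or.inr ⟨m, hW m, rfl⟩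
  haveI : ((I ⊔ wIdeal w W).map (algebraMap R A)).IsMaximal := hmax ▸ maximalIdeal.isMaximal A
  letI := Ideal.Quotient.field ((I ⊔ wIdeal w W).map (algebraMap R A))
  infer_instance

include hu in
/-- The `x_j` lie in `𝔭`. [folklore] -/
theorem x_mem_of_rsop (j : Fin r) : x j ∈ 𝔭 := by
  rw [← IsLocalization.AtPrime.to_map_mem_maximal_iff A 𝔭, ← hu]
  have : algebraMap R A (x j) = uA (Fin.castAdd a j) := by rw [Fin.append_left]
  rw [this]
  exact Ideal.subset_span ⟨_, rfl⟩

include hu in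
/-- The `w_m` lie in `𝔭`. [folklore] -/
theorem w_mem_of_rsop (m : Fin a) : w m ∈ 𝔭 := by
  rw [← IsLocalization.AtPrime.to_map_mem_maximal_iff A 𝔭, ← hu]
  have : algebraMap R A (w m) = uA (Fin.natAdd r m) := by rw [Fin.append_right]
  rw [this]
  exact Ideal.subset_span ⟨_, rfl⟩

include hu in
/-- `(w_W) ⊆ 𝔭`. [folklore] -/
theorem wIdeal_le (W : Set (Fin a)) : wIdeal w W ≤ 𝔭 := by
  rw [wIdeal, Ideal.span_le]
  rintro _ ⟨m, -, rfl⟩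
  exact w_mem_of_rsop x 𝔭 w hu m

/-! ### The chart generators through the point, enumerated -/

open Classical in
/-- The chart generators `e_j`, `j ≠ i`, lying in `Q` (the strict transforms of the `V(x_j)`
through the point). [folklore] -/
def chartGenFinset (Q : Ideal B) : Finset (Fin r) :=
  Finset.univ.filter fun j => j ≠ i ∧ e[j] ∈ Q

omit [𝔭.IsPrime] [IsLocalization.AtPrime A 𝔭] [IsRegularLocalRing A] in
open Classical in
/-- Membership in `chartGenFinset`. [folklore] -/
theorem mem_chartGenFinset_iff (Q : Ideal B) (j : Fin r) :
    j ∈ chartGenFinset x i Q ↔ j ≠ i ∧ e[j] ∈ Q := by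
  simp [chartGenFinset]

/-- The enumeration `l ↦ j_l` of `chartGenFinset`. [folklore] -/
def chartGenEnum (Q : Ideal B) (l : Fin (chartGenFinset x i Q).card) : Fin r :=
  ((chartGenFinset x i Q).equivFin.symm l).1

omit [𝔭.IsPrime] [IsLocalization.AtPrime A 𝔭] [IsRegularLocalRing A] in
/-- `j_l ≠ i` and `e_{j_l} ∈ Q`. [folklore] -/
theorem chartGenEnum_spec (Q : Ideal B) (l : Fin (chartGenFinset x i Q).card) :
    chartGenEnum x i Q l ≠ i ∧ e[chartGenEnum x i Q l] ∈ Q :=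
  (mem_chartGenFinset_iff x i Q _).mp ((chartGenFinset x i Q).equivFin.symm l).2

omit [𝔭.IsPrime] [IsLocalization.AtPrime A 𝔭] [IsRegularLocalRing A] in
/-- The enumeration is injective. [folklore] -/
theorem chartGenEnum_injective (Q : Ideal B) : Function.Injective (chartGenEnum x i Q) :=
  fun _ _ h => (chartGenFinset x i Q).equivFin.symm.injective (Subtype.ext h)

/-! ### The stage ideals of the two phases -/

/-- Phase 1, stage `k`: `(x_i, w_1, …, w_k) S`. [folklore] -/
def wStage (S : Type u) [CommRing S] [Algebra B S] (k : ℕ) : Ideal S :=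
  (chartStageIdeal x i (wIdeal w {m : Fin a | (m : ℕ) < k}) ∅).map (algebraMap B S : B →+* S)

/-- Phase 2, stage `c`: `(x_i, w, e_{j_1}, …, e_{j_c}) S`. [folklore] -/
def eStage (Q : Ideal B) (S : Type u) [CommRing S] [Algebra B S] (c : ℕ) : Ideal S :=
  (chartStageIdeal x i (wIdeal w {m : Fin a | (m : ℕ) < a})
    (chartGenEnum x i Q '' {l : Fin (chartGenFinset x i Q).card | (l : ℕ) < c})).map
      (algebraMap B S : B →+* S)

omit [𝔭.IsPrime] [IsLocalization.AtPrime A 𝔭] [IsRegularLocalRing A] in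
/-- `J(0, ∅) = (φ x_i)`. [folklore] -/
theorem chartStageIdeal_bot_empty : chartStageIdeal x i ⊥ ∅ = Ideal.span {φ (x i)} := by
  rw [chartStageIdeal, Ideal.map_bot, Set.image_empty, Ideal.span_empty, sup_bot_eq, sup_bot_eq]

omit [𝔭.IsPrime] [IsLocalization.AtPrime A 𝔭] [IsRegularLocalRing A] in
/-- Stage `0` of phase 1 is `(x_i) S`. [folklore] -/
theorem wStage_zero (S : Type u) [CommRing S] [Algebra B S] :
    wStage x i w S 0 = Ideal.span {(algebraMap B S : B →+* S) (φ (x i))} := by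
  have h0 : wIdeal w {m : Fin a | (m : ℕ) < 0} = ⊥ := by
    rw [wIdeal, show {m : Fin a | (m : ℕ) < 0} = ∅ from Set.ext fun m => by simp, Set.image_empty,
      Ideal.span_empty]
  rw [wStage, h0, chartStageIdeal_bot_empty, Ideal.map_span, Set.image_singleton]

omit [𝔭.IsPrime] [IsLocalization.AtPrime A 𝔭] [IsRegularLocalRing A] in
/-- Stage `k + 1` of phase 1 adds `w_k`. [folklore] -/
theorem wStage_succ (S : Type u) [CommRing S] [Algebra B S] {k : ℕ} (hk : k < a) :
    wStage x i w S (k + 1) =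
      wStage x i w S k ⊔ Ideal.span {(algebraMap B S : B →+* S) (φ (w ⟨k, hk⟩))} := by
  have h1 : wIdeal w {m : Fin a | (m : ℕ) < k + 1} =
      wIdeal w {m : Fin a | (m : ℕ) < k} ⊔ Ideal.span {w ⟨k, hk⟩} := by
    rw [wIdeal, wIdeal, show {m : Fin a | (m : ℕ) < k + 1} = insert ⟨k, hk⟩ {m : Fin a | (m : ℕ) < k}
      from Set.ext fun m => by
        simp only [Set.mem_setOf_eq, Set.mem_insert_iff, Fin.ext_iff]
        omega,
      Set.image_insert_eq, Ideal.span_insert, sup_comm]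
  rw [wStage, wStage, h1, chartStageIdeal_sup_span_singleton, Ideal.map_sup, Ideal.map_span,
    Set.image_singleton]

omit [𝔭.IsPrime] [IsLocalization.AtPrime A 𝔭] [IsRegularLocalRing A] in
/-- Stage `0` of phase 2 is the last stage of phase 1. [folklore] -/
theorem eStage_zero (Q : Ideal B) (S : Type u) [CommRing S] [Algebra B S] :
    eStage x i w Q S 0 = wStage x i w S a := by
  rw [eStage, wStage, show {l : Fin (chartGenFinset x i Q).card | (l : ℕ) < 0} = ∅
    from Set.ext fun l => by simp, Set.image_empty]

omit [𝔭.IsPrime] [IsLocalization.AtPrime A 𝔭] [IsRegularLocalRing A] in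
/-- Stage `c + 1` of phase 2 adds `e_{j_c}`. [folklore] -/
theorem eStage_succ (Q : Ideal B) (S : Type u) [CommRing S] [Algebra B S] {c : ℕ}
    (hc : c < (chartGenFinset x i Q).card) :
    eStage x i w Q S (c + 1) =
      eStage x i w Q S c ⊔ Ideal.span {(algebraMap B S : B →+* S) e[chartGenEnum x i Q ⟨c, hc⟩]} := by
  have h1 : chartGenEnum x i Q '' {l : Fin (chartGenFinset x i Q).card | (l : ℕ) < c + 1} =
      insert (chartGenEnum x i Q ⟨c, hc⟩)
        (chartGenEnum x i Q '' {l : Fin (chartGenFinset x i Q).card | (l : ℕ) < c}) := by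
    rw [show {l : Fin (chartGenFinset x i Q).card | (l : ℕ) < c + 1} =
        insert ⟨c, hc⟩ {l : Fin (chartGenFinset x i Q).card | (l : ℕ) < c}
      from Set.ext fun l => by
        simp only [Set.mem_setOf_eq, Set.mem_insert_iff, Fin.ext_iff]
        omega,
      Set.image_insert_eq]
  rw [eStage, eStage, h1, chartStageIdeal_insert, Ideal.map_sup, Ideal.map_span, Set.image_singleton]

include hd hu in
/-- **Phase 1**: `dim S/(x_i, w_1..w_k) + k ≤ dim S/(x_i)` — each `w_k` is nonzero in the domain
`S/(x_i, w_{<k})`. [folklore] -/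
theorem ringKrullDim_wStage_add_le (hx : IsQuasiRegular x) (Q : Ideal B) [Q.IsPrime] (S : Type u)
    [CommRing S] [Algebra B S] [IsLocalization.AtPrime S Q] (hxi : φ (x i) ∈ Q)
    (hQ : ∀ s : R, φ s ∈ Q ↔ s ∈ 𝔭) (k : ℕ) (hk : k ≤ a) :
    ringKrullDim (S ⧸ wStage x i w S k) + k ≤ ringKrullDim (S ⧸ wStage x i w S 0) := by
  induction k with
  | zero => simp
  | succ k ih =>
    have hk' : k < a := hk
    haveI := isDomain_quotient_map_sup_wIdeal x w hd hu {m : Fin a | (m : ℕ) < k}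
    haveI : IsDomain (S ⧸ wStage x i w S k) :=
      isDomain_quotient_map_chartStageIdeal (A := A) x i _ ∅ 𝔭 hx (Set.notMem_empty i) Q S
        (fun j hj => absurd hj (Set.notMem_empty j)) hxi hQ (wIdeal_le x 𝔭 w hu _)
    have hne := mk_algebraMap_reesChartBase_ne_zero (A := A) x i
      (wIdeal w {m : Fin a | (m : ℕ) < k}) ∅ 𝔭 hx (Set.notMem_empty i) Q S
      (fun j hj => absurd hj (Set.notMem_empty j)) hxi hQ (wIdeal_le x 𝔭 w hu _)
      (mk_algebraMap_w_ne_zero x w hd hu (W := {m : Fin a | (m : ℕ) < k}) (m := ⟨k, hk'⟩)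
        (by simp))
    have hstep := ringKrullDim_quotient_sup_span_singleton_succ_le (wStage x i w S k) _ hne
    rw [← wStage_succ x i w S hk'] at hstep
    calc ringKrullDim (S ⧸ wStage x i w S (k + 1)) + ((k + 1 : ℕ) : WithBot ℕ∞)
        = ringKrullDim (S ⧸ wStage x i w S (k + 1)) + 1 + k := by
          rw [Nat.cast_succ, add_comm (k : WithBot ℕ∞) 1, add_assoc]
      _ ≤ ringKrullDim (S ⧸ wStage x i w S k) + k := add_le_add hstep le_rfl
      _ ≤ ringKrullDim (S ⧸ wStage x i w S 0) := ih hk'.le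

include hd hu in
/-- **Phase 2**: `dim S/(x_i, w, e_{j_1..j_c}) + c ≤ dim S/(x_i, w)` — each `e_{j_c}` is nonzero
in the domain `S/(x_i, w, e_{j_{<c}})`. [folklore] -/
theorem ringKrullDim_eStage_add_le (hx : IsQuasiRegular x) (Q : Ideal B) [Q.IsPrime] (S : Type u)
    [CommRing S] [Algebra B S] [IsLocalization.AtPrime S Q] (hxi : φ (x i) ∈ Q)
    (hQ : ∀ s : R, φ s ∈ Q ↔ s ∈ 𝔭) (c : ℕ) (hc : c ≤ (chartGenFinset x i Q).card) :
    ringKrullDim (S ⧸ eStage x i w Q S c) + c ≤ ringKrullDim (S ⧸ eStage x i w Q S 0) := by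
  induction c with
  | zero => simp
  | succ c ih =>
    have hc' : c < (chartGenFinset x i Q).card := hc
    set Tc : Set (Fin r) :=
      chartGenEnum x i Q '' {l : Fin (chartGenFinset x i Q).card | (l : ℕ) < c} with hTc
    have hiT : i ∉ Tc := by
      rintro ⟨l, -, hl⟩
      exact (chartGenEnum_spec x i Q l).1 hl
    have hT : ∀ j ∈ Tc, e[j] ∈ Q := by
      rintro _ ⟨l, -, rfl⟩
      exact (chartGenEnum_spec x i Q l).2
    have hjT : chartGenEnum x i Q ⟨c, hc'⟩ ∉ Tc := by
      rintro ⟨l, hl, hll⟩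
      have := congrArg Fin.val (chartGenEnum_injective x i Q hll)
      simp only [Set.mem_setOf_eq] at hl
      simp at this
      omega
    haveI := isDomain_quotient_map_sup_wIdeal x w hd hu {m : Fin a | (m : ℕ) < a}
    haveI : IsDomain (S ⧸ eStage x i w Q S c) :=
      isDomain_quotient_map_chartStageIdeal (A := A) x i _ Tc 𝔭 hx hiT Q S hT hxi hQ
        (wIdeal_le x 𝔭 w hu _)
    have hne := mk_algebraMap_chartGen_ne_zero (A := A) x i
      (wIdeal w {m : Fin a | (m : ℕ) < a}) Tc 𝔭 hx hiT Q S hT hxi hQ (wIdeal_le x 𝔭 w hu _)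
      ⟨chartGenEnum x i Q ⟨c, hc'⟩, (chartGenEnum_spec x i Q _).1, hjT⟩
    have hstep := ringKrullDim_quotient_sup_span_singleton_succ_le (eStage x i w Q S c) _ hne
    rw [← eStage_succ x i w Q S hc'] at hstep
    calc ringKrullDim (S ⧸ eStage x i w Q S (c + 1)) + ((c + 1 : ℕ) : WithBot ℕ∞)
        = ringKrullDim (S ⧸ eStage x i w Q S (c + 1)) + 1 + c := by
          rw [Nat.cast_succ, add_comm (c : WithBot ℕ∞) 1, add_assoc]
      _ ≤ ringKrullDim (S ⧸ eStage x i w Q S c) + c := add_le_add hstep le_rfl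
      _ ≤ ringKrullDim (S ⧸ eStage x i w Q S 0) := ih hc'.le

/-! ### The regular system of parameters of `S` -/

/-- The family `(x_i, w_1, …, w_a, e_{j_1}, …, e_{j_b})` in `S = B_Q`. [folklore] -/
def chartRsopFamily (Q : Ideal B) (S : Type u) [CommRing S] [Algebra B S] :
    Fin ((a + (chartGenFinset x i Q).card) + 1) → S :=
  Fin.cons ((algebraMap B S : B →+* S) (φ (x i)))
    (Fin.append (fun m : Fin a => (algebraMap B S : B →+* S) (φ (w m)))
      (fun l => (algebraMap B S : B →+* S) e[chartGenEnum x i Q l]))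

omit [𝔭.IsPrime] [IsLocalization.AtPrime A 𝔭] [IsRegularLocalRing A] in
/-- Value at `0`: `x_i`. [folklore] -/
theorem chartRsopFamily_zero (Q : Ideal B) (S : Type u) [CommRing S] [Algebra B S] :
    chartRsopFamily x i w Q S 0 = (algebraMap B S : B →+* S) (φ (x i)) := by
  rw [chartRsopFamily, Fin.cons_zero]

omit [𝔭.IsPrime] [IsLocalization.AtPrime A 𝔭] [IsRegularLocalRing A] in
/-- Values at `1, …, a`: the `w_m`. [folklore] -/
theorem chartRsopFamily_succ_castAdd (Q : Ideal B) (S : Type u) [CommRing S] [Algebra B S]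
    (m : Fin a) :
    chartRsopFamily x i w Q S (Fin.succ (Fin.castAdd _ m)) = (algebraMap B S : B →+* S) (φ (w m)) := by
  rw [chartRsopFamily, Fin.cons_succ, Fin.append_left]

omit [𝔭.IsPrime] [IsLocalization.AtPrime A 𝔭] [IsRegularLocalRing A] in
/-- Values at `a + 1, …`: the `e_{j_l}`. [folklore] -/
theorem chartRsopFamily_succ_natAdd (Q : Ideal B) (S : Type u) [CommRing S] [Algebra B S]
    (l : Fin (chartGenFinset x i Q).card) :
    chartRsopFamily x i w Q S (Fin.succ (Fin.natAdd a l)) =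
      (algebraMap B S : B →+* S) e[chartGenEnum x i Q l] := by
  rw [chartRsopFamily, Fin.cons_succ, Fin.append_right]

omit [𝔭.IsPrime] [IsLocalization.AtPrime A 𝔭] [IsRegularLocalRing A] in
/-- **The family generates the last stage ideal**: `(x_i, w, e_{j_1}, …, e_{j_b}) S`. [folklore] -/
theorem span_range_chartRsopFamily (Q : Ideal B) (S : Type u) [CommRing S] [Algebra B S] :
    Ideal.span (Set.range (chartRsopFamily x i w Q S)) =
      eStage x i w Q S (chartGenFinset x i Q).card := by
  apply le_antisymm
  · rw [Ideal.span_le]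
    rintro _ ⟨t, rfl⟩
    rw [SetLike.mem_coe, eStage]
    induction t using Fin.cases with
    | zero =>
      rw [chartRsopFamily_zero]
      exact Ideal.mem_map_of_mem _ (reesChartBase_self_mem_chartStageIdeal x i _ _)
    | succ t =>
      induction t using Fin.addCases with
      | left m =>
        rw [chartRsopFamily_succ_castAdd]
        exact Ideal.mem_map_of_mem _ (reesChartBase_mem_chartStageIdeal_of_mem x i _
          (Ideal.subset_span ⟨m, m.isLt, rfl⟩))
      | right l =>
        rw [chartRsopFamily_succ_natAdd]
        exact Ideal.mem_map_of_mem _ (chartGen_mem_chartStageIdeal x i _ ⟨l, l.isLt, rfl⟩)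
  · rw [eStage, Ideal.map_le_iff_le_comap, chartStageIdeal]
    refine sup_le (sup_le ?_ ?_) ?_
    · rw [Ideal.span_singleton_le_iff_mem, Ideal.mem_comap, ← chartRsopFamily_zero x i w Q S]
      exact Ideal.subset_span ⟨0, rfl⟩
    · rw [wIdeal, Ideal.map_span, Ideal.span_le]
      rintro _ ⟨_, ⟨m, -, rfl⟩, rfl⟩
      rw [SetLike.mem_coe, Ideal.mem_comap, ← chartRsopFamily_succ_castAdd x i w Q S m]
      exact Ideal.subset_span ⟨_, rfl⟩
    · rw [Ideal.span_le]
      rintro _ ⟨_, ⟨l, -, rfl⟩, rfl⟩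
      rw [SetLike.mem_coe, Ideal.mem_comap, ← chartRsopFamily_succ_natAdd x i w Q S l]
      exact Ideal.subset_span ⟨_, rfl⟩

include hd hu in
/-- **`(x_i, w_1, …, w_a, e_{j_1}, …, e_{j_b})` is part of a regular system of parameters of the
local ring `S = B_Q` of the blow-up chart at a point of the exceptional divisor over the closed
point of `A`** (in particular `S` is regular): the quotient is a localization of a polynomial
ring over the residue field (regular), and the dimension count of phases 1–2 together with
`x_i ∈ S⁰`. [cite: Kollar2007, Def. 3.25] [cite: Matsumura1987, Thm. 14.2 (Remark)] -/
theorem isRsopPart_chartRsopFamily [IsNoetherianRing R] (hx : IsQuasiRegular x) (Q : Ideal B)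
    [Q.IsPrime] (S : Type u) [CommRing S] [Algebra B S] [IsLocalization.AtPrime S Q] [IsLocalRing S]
    (hxi : φ (x i) ∈ Q) (hQ : ∀ s : R, φ s ∈ Q ↔ s ∈ 𝔭) :
    IsRsopPart (chartRsopFamily x i w Q S) := by
  haveI : IsNoetherianRing S :=
    IsLocalization.isNoetherianRing Q.primeCompl S (isNoetherianRing_blowupChart x i)
  -- all members lie in `𝔪_S`
  have hzm : ∀ t, chartRsopFamily x i w Q S t ∈ maximalIdeal S := by
    intro t
    induction t using Fin.cases with
    | zero =>
      rw [chartRsopFamily_zero]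
      exact (IsLocalization.AtPrime.to_map_mem_maximal_iff S Q _).mpr hxi
    | succ t =>
      induction t using Fin.addCases with
      | left m =>
        rw [chartRsopFamily_succ_castAdd]
        exact (IsLocalization.AtPrime.to_map_mem_maximal_iff S Q _).mpr
          ((hQ _).mpr (w_mem_of_rsop x 𝔭 w hu m))
      | right l =>
        rw [chartRsopFamily_succ_natAdd]
        exact (IsLocalization.AtPrime.to_map_mem_maximal_iff S Q _).mpr (chartGenEnum_spec x i Q l).2
  have hspan := span_range_chartRsopFamily x i w Q S
  -- the last quotient is regular
  set Tb : Set (Fin r) := chartGenEnum x i Q ''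
    {l : Fin (chartGenFinset x i Q).card | (l : ℕ) < (chartGenFinset x i Q).card} with hTb
  have hiT : i ∉ Tb := by
    rintro ⟨l, -, hl⟩
    exact (chartGenEnum_spec x i Q l).1 hl
  have hT : ∀ j ∈ Tb, e[j] ∈ Q := by
    rintro _ ⟨l, -, rfl⟩
    exact (chartGenEnum_spec x i Q l).2
  haveI := isRegularRing_quotient_map_sup_wIdeal x w hu (W := {m : Fin a | (m : ℕ) < a})
    fun m => m.isLt
  haveI hreg : IsRegularLocalRing (S ⧸ eStage x i w Q S (chartGenFinset x i Q).card) :=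
    isRegularLocalRing_quotient_map_chartStageIdeal (A := A) x i _ Tb 𝔭 hx hiT Q S hT hxi hQ
      (wIdeal_le x 𝔭 w hu _)
  haveI : IsRegularLocalRing (S ⧸ Ideal.span (Set.range (chartRsopFamily x i w Q S))) :=
    IsRegularLocalRing.of_ringEquiv (R := S ⧸ eStage x i w Q S (chartGenFinset x i Q).card)
      (Ideal.quotEquivOfEq hspan.symm)
  -- the dimension count
  refine IsRsopPart.of_isRegularLocalRing_quotient hzm ?_
  rw [ringKrullDim_eq_of_ringEquiv (Ideal.quotEquivOfEq hspan)]
  have h2 := ringKrullDim_eStage_add_le x i 𝔭 w hd hu hx Q S hxi hQ _ le_rfl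
  rw [eStage_zero] at h2
  have h1 := ringKrullDim_wStage_add_le x i 𝔭 w hd hu hx Q S hxi hQ a le_rfl
  rw [wStage_zero] at h1
  have hnzd : (algebraMap B S : B →+* S) (φ (x i)) ∈ nonZeroDivisors S :=
    IsLocalization.nonZeroDivisors_le_comap Q.primeCompl S
      (reesChartBase_mem_nonZeroDivisors (x i) (Ideal.mem_span_range_self (f := x) (x := i)))
  have h0 := ringKrullDim_quotient_succ_le_of_nonZeroDivisor hnzd
  calc ringKrullDim (S ⧸ eStage x i w Q S (chartGenFinset x i Q).card) +
        ((a + (chartGenFinset x i Q).card + 1 : ℕ) : WithBot ℕ∞)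
      = ringKrullDim (S ⧸ eStage x i w Q S (chartGenFinset x i Q).card) +
          ((chartGenFinset x i Q).card : WithBot ℕ∞) + a + 1 := by
        push_cast
        rw [add_comm (a : WithBot ℕ∞) _, add_assoc, add_assoc, add_assoc]
    _ ≤ ringKrullDim (S ⧸ wStage x i w S a) + a + 1 :=
        add_le_add (add_le_add h2 le_rfl) le_rfl
    _ ≤ ringKrullDim (S ⧸ Ideal.span {(algebraMap B S : B →+* S) (φ (x i))}) + 1 :=
        add_le_add h1 le_rfl
    _ ≤ ringKrullDim S := h0

/-! ### The labelled regular system of parameters (the form consumed by `HasSNCWith`) -/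

/-- The positions of `x_i` (label `none`), `w_m` (label `inl m`) and `e_j` (label `inr j`) in the
family `chartRsopFamily`. [folklore] -/
def chartRsopIndex (Q : Ideal B) :
    Option (Fin a ⊕ {j : Fin r // j ≠ i ∧ e[j] ∈ Q}) → Fin ((a + (chartGenFinset x i Q).card) + 1)
  | none => 0
  | some (Sum.inl m) => Fin.succ (Fin.castAdd _ m)
  | some (Sum.inr j) => Fin.succ (Fin.natAdd a
      ((chartGenFinset x i Q).equivFin ⟨j.1, (mem_chartGenFinset_iff x i Q j.1).mpr j.2⟩))

omit [𝔭.IsPrime] [IsLocalization.AtPrime A 𝔭] [IsRegularLocalRing A] in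
/-- The index map is injective. [folklore] -/
theorem chartRsopIndex_injective (Q : Ideal B) :
    Function.Injective (chartRsopIndex (a := a) x i Q) := by
  intro o o' h
  rcases o with _ | (m | j) <;> rcases o' with _ | (m' | j')
  · rfl
  · exact absurd (congrArg Fin.val h) (by simp [chartRsopIndex])
  · exact absurd (congrArg Fin.val h) (by simp [chartRsopIndex])
  · exact absurd (congrArg Fin.val h) (by simp [chartRsopIndex])
  · have := congrArg Fin.val h
    simp [chartRsopIndex] at this
    rw [Fin.ext this]
  · have := congrArg Fin.val h
    simp [chartRsopIndex] at this
    omega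
  · exact absurd (congrArg Fin.val h) (by simp [chartRsopIndex])
  · have := congrArg Fin.val h
    simp [chartRsopIndex] at this
    omega
  · have := congrArg Fin.val h
    simp only [chartRsopIndex, Fin.val_succ, Fin.natAdd, add_left_inj, add_right_inj] at this
    have h2 := (chartGenFinset x i Q).equivFin.injective (Fin.ext this)
    rw [Subtype.mk.injEq] at h2
    rw [Subtype.ext h2]

omit [𝔭.IsPrime] [IsLocalization.AtPrime A 𝔭] [IsRegularLocalRing A] in
/-- Value of the family at the position labelled `none`: `x_i`. [folklore] -/
theorem chartRsopFamily_index_none (Q : Ideal B) (S : Type u) [CommRing S] [Algebra B S] :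
    chartRsopFamily x i w Q S (chartRsopIndex (a := a) x i Q none) =
      (algebraMap B S : B →+* S) (φ (x i)) :=
  chartRsopFamily_zero x i w Q S

omit [𝔭.IsPrime] [IsLocalization.AtPrime A 𝔭] [IsRegularLocalRing A] in
/-- Value of the family at the position labelled `inl m`: `w_m`. [folklore] -/
theorem chartRsopFamily_index_inl (Q : Ideal B) (S : Type u) [CommRing S] [Algebra B S] (m : Fin a) :
    chartRsopFamily x i w Q S (chartRsopIndex (a := a) x i Q (some (Sum.inl m))) =
      (algebraMap B S : B →+* S) (φ (w m)) :=
  chartRsopFamily_succ_castAdd x i w Q S m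

omit [𝔭.IsPrime] [IsLocalization.AtPrime A 𝔭] [IsRegularLocalRing A] in
/-- Value of the family at the position labelled `inr j`: `e_j`. [folklore] -/
theorem chartRsopFamily_index_inr (Q : Ideal B) (S : Type u) [CommRing S] [Algebra B S]
    (j : {j : Fin r // j ≠ i ∧ e[j] ∈ Q}) :
    chartRsopFamily x i w Q S (chartRsopIndex (a := a) x i Q (some (Sum.inr j))) =
      (algebraMap B S : B →+* S) e[j.1] := by
  change chartRsopFamily x i w Q S (Fin.succ (Fin.natAdd a _)) = _
  rw [chartRsopFamily_succ_natAdd, chartGenEnum, Equiv.symm_apply_apply]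

include hd hu in
/-- **The local ring `S = B_Q` of the chart at a point of the exceptional divisor over the closed
point of `A` is regular, with a regular system of parameters containing `x_i` (the exceptional
divisor), the `w_m` (the old coordinates not in the centre) and the `e_j ∈ Q`, `j ≠ i` (the strict
transforms of the old coordinates in the centre through the point), at distinct positions.**
This is the local content of Kollár 2007, Def. 3.25 ("then `Π_tot⁻¹(E)` is a simple normal
crossing divisor") and of BGMW Def. 3.1.3 (2), (4). [cite: Kollar2007, Def. 3.25] -/
theorem exists_rsop_chart [IsNoetherianRing R] (hx : IsQuasiRegular x) (Q : Ideal B) [Q.IsPrime]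
    (S : Type u) [CommRing S] [Algebra B S] [IsLocalization.AtPrime S Q] [IsLocalRing S]
    (hxi : φ (x i) ∈ Q) (hQ : ∀ s : R, φ s ∈ Q ↔ s ∈ 𝔭) :
    IsRegularLocalRing S ∧
      ∃ (d : ℕ) (v : Fin d → S), (maximalIdeal S).spanFinrank = d ∧
        Ideal.span (Set.range v) = maximalIdeal S ∧
        ∃ lab : Option (Fin a ⊕ {j : Fin r // j ≠ i ∧ e[j] ∈ Q}) → Fin d,
          Function.Injective lab ∧
          v (lab none) = (algebraMap B S : B →+* S) (φ (x i)) ∧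
          (∀ m : Fin a, v (lab (some (Sum.inl m))) = (algebraMap B S : B →+* S) (φ (w m))) ∧
          (∀ j : {j : Fin r // j ≠ i ∧ e[j] ∈ Q},
            v (lab (some (Sum.inr j))) = (algebraMap B S : B →+* S) e[j.1]) := by
  have hz := isRsopPart_chartRsopFamily x i 𝔭 w hd hu hx Q S hxi hQ
  obtain ⟨e, v, hsf, hspan, hvz⟩ := hz.exists_rsop
  refine ⟨hz.isRegularLocalRing, _, v, hsf, hspan,
    fun o => Fin.castAdd e (chartRsopIndex (a := a) x i Q o), ?_, ?_, ?_, ?_⟩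
  · intro o o' h
    apply chartRsopIndex_injective x i Q
    have := congrArg Fin.val h
    simp only [Fin.val_castAdd] at this
    exact Fin.ext this
  · rw [hvz, chartRsopFamily_index_none]
  · intro m
    rw [hvz, chartRsopFamily_index_inl]
  · intro j
    rw [hvz, chartRsopFamily_index_inr]

/-! ### The stalks of the strict transforms: saturations by `x_i` -/

omit [𝔭.IsPrime] [IsLocalization.AtPrime A 𝔭] [IsRegularLocalRing A] in
/-- In a domain quotient `S/(t)`, a nonzero class is a nonzerodivisor modulo `t`. [folklore] -/
theorem mem_span_singleton_of_mul_mem_of_isDomain {S : Type*} [CommRing S] {t c : S}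
    [IsDomain (S ⧸ Ideal.span {t})] (hc : Ideal.Quotient.mk (Ideal.span {t}) c ≠ 0) (y : S)
    (hy : c * y ∈ Ideal.span {t}) : y ∈ Ideal.span {t} := by
  rw [← Ideal.Quotient.eq_zero_iff_mem, map_mul] at hy
  rw [← Ideal.Quotient.eq_zero_iff_mem]
  exact (mul_eq_zero.mp hy).resolve_left hc

include hd hu in
/-- `S/(x_i)` is a domain and the `w_m`, `e_j` (`j ≠ i`) are nonzero in it (stage `(∅, ∅)`).
[folklore] -/
theorem isDomain_quotient_span_x_and [IsNoetherianRing R] (hx : IsQuasiRegular x) (Q : Ideal B)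
    [Q.IsPrime] (S : Type u) [CommRing S] [Algebra B S] [IsLocalization.AtPrime S Q]
    (hxi : φ (x i) ∈ Q) (hQ : ∀ s : R, φ s ∈ Q ↔ s ∈ 𝔭) :
    IsDomain (S ⧸ Ideal.span {(algebraMap B S : B →+* S) (φ (x i))}) ∧
      (∀ m : Fin a, Ideal.Quotient.mk (Ideal.span {(algebraMap B S : B →+* S) (φ (x i))})
        ((algebraMap B S : B →+* S) (φ (w m))) ≠ 0) ∧
      (∀ j : Fin r, j ≠ i → Ideal.Quotient.mk (Ideal.span {(algebraMap B S : B →+* S) (φ (x i))})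
        ((algebraMap B S : B →+* S) e[j]) ≠ 0) := by
  haveI := isDomain_quotient_map_sup_wIdeal x w hd hu {m : Fin a | (m : ℕ) < 0}
  have h0 := wStage_zero x i w S
  rw [wStage] at h0
  haveI hdom : IsDomain (S ⧸ (chartStageIdeal x i (wIdeal w {m : Fin a | (m : ℕ) < 0}) ∅).map
      (algebraMap B S : B →+* S)) :=
    isDomain_quotient_map_chartStageIdeal (A := A) x i _ ∅ 𝔭 hx (Set.notMem_empty i) Q S
      (fun j hj => absurd hj (Set.notMem_empty j)) hxi hQ (wIdeal_le x 𝔭 w hu _)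
  have hw := fun m : Fin a => mk_algebraMap_reesChartBase_ne_zero (A := A) x i
    (wIdeal w {m : Fin a | (m : ℕ) < 0}) ∅ 𝔭 hx (Set.notMem_empty i) Q S
    (fun j hj => absurd hj (Set.notMem_empty j)) hxi hQ (wIdeal_le x 𝔭 w hu _)
    (mk_algebraMap_w_ne_zero x w hd hu (W := {m : Fin a | (m : ℕ) < 0}) (m := m) (by simp))
  have he := fun (j : Fin r) (hj : j ≠ i) => mk_algebraMap_chartGen_ne_zero (A := A) x i
    (wIdeal w {m : Fin a | (m : ℕ) < 0}) ∅ 𝔭 hx (Set.notMem_empty i) Q S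
    (fun j hj => absurd hj (Set.notMem_empty j)) hxi hQ (wIdeal_le x 𝔭 w hu _)
    ⟨j, hj, Set.notMem_empty j⟩
  rw [h0] at hdom hw he
  exact ⟨hdom, hw, he⟩

include hd hu in
/-- **The strict transform of `V(w_m)` through the point is `V(w_m)`**: in `S`,
`⋃ₙ ((w_m) : x_iⁿ) = (w_m)` (`x_i` is a nonzerodivisor modulo `w_m`, by swapping the regular
sequence `x_i, w_m`). [cite: Kollar2007, Def. 3.25] -/
theorem iSup_colon_span_w_eq [IsNoetherianRing R] (hx : IsQuasiRegular x) (Q : Ideal B)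
    [Q.IsPrime] (S : Type u) [CommRing S] [Algebra B S] [IsLocalization.AtPrime S Q]
    (hxi : φ (x i) ∈ Q) (hQ : ∀ s : R, φ s ∈ Q ↔ s ∈ 𝔭) (m : Fin a) :
    ⨆ n : ℕ, Submodule.colon (Ideal.span {(algebraMap B S : B →+* S) (φ (w m))})
        ((Ideal.span {(algebraMap B S : B →+* S) (φ (x i))} ^ n : Ideal S) : Set S) =
      Ideal.span {(algebraMap B S : B →+* S) (φ (w m))} := by
  obtain ⟨hdom, hw, -⟩ := isDomain_quotient_span_x_and x i 𝔭 w hd hu hx Q S hxi hQ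
  have hnzd : (algebraMap B S : B →+* S) (φ (x i)) ∈ nonZeroDivisors S :=
    IsLocalization.nonZeroDivisors_le_comap Q.primeCompl S
      (reesChartBase_mem_nonZeroDivisors (x i) (Ideal.mem_span_range_self (f := x) (x := i)))
  exact iSup_colon_span_singleton_pow_eq_of_regular fun y hy =>
    mem_span_singleton_of_mul_mem_of_swap hnzd
      (mem_span_singleton_of_mul_mem_of_isDomain (hw m)) hy

include hd hu in
/-- **The strict transform of `V(x_j)`, `j ≠ i`, through the point is `V(e_j)`**: in `S`,
`⋃ₙ ((x_j) : x_iⁿ) = (e_j)` (`φ x_j = φ x_i · e_j`, and `x_i` is a nonzerodivisor modulo `e_j`).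
[cite: Kollar2007, Def. 3.25] -/
theorem iSup_colon_span_x_eq [IsNoetherianRing R] (hx : IsQuasiRegular x) (Q : Ideal B)
    [Q.IsPrime] (S : Type u) [CommRing S] [Algebra B S] [IsLocalization.AtPrime S Q]
    (hxi : φ (x i) ∈ Q) (hQ : ∀ s : R, φ s ∈ Q ↔ s ∈ 𝔭) {j : Fin r} (hj : j ≠ i) :
    ⨆ n : ℕ, Submodule.colon (Ideal.span {(algebraMap B S : B →+* S) (φ (x j))})
        ((Ideal.span {(algebraMap B S : B →+* S) (φ (x i))} ^ n : Ideal S) : Set S) =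
      Ideal.span {(algebraMap B S : B →+* S) e[j]} := by
  obtain ⟨hdom, -, he⟩ := isDomain_quotient_span_x_and x i 𝔭 w hd hu hx Q S hxi hQ
  have hnzd : (algebraMap B S : B →+* S) (φ (x i)) ∈ nonZeroDivisors S :=
    IsLocalization.nonZeroDivisors_le_comap Q.primeCompl S
      (reesChartBase_mem_nonZeroDivisors (x i) (Ideal.mem_span_range_self (f := x) (x := i)))
  rw [reesChartBase_apply_eq_mul_chartGen x i j, map_mul]
  exact iSup_colon_span_singleton_mul_pow_eq hnzd fun y hy =>
    mem_span_singleton_of_mul_mem_of_swap hnzd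
      (mem_span_singleton_of_mul_mem_of_isDomain (he j hj)) hy

omit [𝔭.IsPrime] [IsLocalization.AtPrime A 𝔭] [IsRegularLocalRing A] in
/-- **The strict transform of `V(x_i)` misses the chart**: `⋃ₙ ((x_i) : x_iⁿ) = S`. [folklore] -/
theorem iSup_colon_span_x_self_eq_top (S : Type u) [CommRing S] [Algebra B S] :
    ⨆ n : ℕ, Submodule.colon (Ideal.span {(algebraMap B S : B →+* S) (φ (x i))})
        ((Ideal.span {(algebraMap B S : B →+* S) (φ (x i))} ^ n : Ideal S) : Set S) = ⊤ :=
  iSup_colon_span_singleton_self_pow_eq_top _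

end Rsop

end Chart

end Literature.AlgebraicGeometry.Resolution

end
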